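import Literature.NumberTheory.PAdicHodge.DeRhamSupersingular
import Literature.NumberTheory.EllipticCurves.FormalGroupEtaHasseInvariantProofs
import HarnessLib

/-!
# `V_pE` IS de Rham at every prime `p ≥ 5` of good SUPERSINGULAR reduction of a `ℤ`-model (unconditional)

Topic `Literature/NumberTheory/PAdicHodge`; namespace `Literature.NumberTheory.PAdicHodge`. THEOREMS ONLY (no definition, no named
fact, no instance, no `sorry`).

The end of the `p`-adic period road (Fontaine 1982 §5, Colmez 1992 §2) for curves with a `ℤ`-model: the last hypothesis
`p ∤ B_p(W)` of `isDeRham_rationalTateRep_curveF_of_supersingular` (file `DeRhamSupersingular`; `B_p(W) = [X^{p−1}] g_W` the η-Hasse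
invariant) is the tree theorem `Literature.NumberTheory.EllipticCurves.prime_not_dvd_coeff_formalQuasiPeriodIntegrand_of_hasseCoeff_eq_zero` (file
`EllipticCurves/FormalGroupEtaHasseInvariantProofs`: for a nonsingular cubic `A_p = B_p = 0` is impossible). Hence, with standard axioms
and no residual hypothesis:

* `isDeRham_rationalTateRep_curveF_of_goodSupersingular` — **for every integral Weierstrass equation `W/ℤ`, every prime `p ≥ 5` with
  `p ∤ Δ_W` and `A_p(W mod p) = 0`, every `p`-adic field `F` (any `ℚ_p`-algebra structure), `V_p(W ×_ℤ F)|_{Γ_F}` is de Rham for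
  Fontaine's `bdRPeriodRingData hp`**;
* `isDeRham_restrictedRationalTateRep_of_goodSupersingular` — the same for a curve over a subfield `K₀ ⊆ F` whose base change to `F` is
  `W ×_ℤ F` (the currency of the cite-only fact `isDeRham_restrictedRationalTateRep`; e.g. `E/ℚ` with good supersingular reduction at `p`).

This is the GOOD-SUPERSINGULAR sector (iii) of the cite-only fact `isDeRham_restrictedRationalTateRep` for curves with a good `ℤ`-model,
complementing the (potentially) good ORDINARY sector (`isDeRham_restrictedRationalTateRep_of_goodOrdinary`, `…_of_potentiallyGoodOrdinary`).
NOT covered: additive potentially-supersingular reduction (K★'s cells of BSD route EdixhovenFibreFiveSeven: need the ramified-coefficient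
tower (R1)), multiplicative reduction, `p ≤ 3`. BSD is not proved by any of this; `isDeRham_restrictedRationalTateRep` stays cite-only.

Ingredients (all tree theorems): period homs `omegaPeriodHom`/`etaPeriodHom` on `T_pŴ(𝒪_{ℂ_F})` (seats edix-p1 g13/g14), their
`ℤ_p`-linearity (E0), the matching `tateGeomEquivTatePtSS` (edix-p4 g10), the functional criterion `DeRhamOfPeriodHoms`, the socket
`DeRhamOfTatePtPeriods`, the witnesses `AinfWeierstrassSupersingularTorsion` / `AinfWeierstrassOmegaPeriodNonvanishing`, the η-Hasse
criterion/congruence/invariant files.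

## References
* [Fontaine1982FormesDifferentielles] J.-M. Fontaine, Invent. Math. 65 (1982), §5 (`V_pA` is de Rham).
* [Colmez1992PeriodesAbeliennes] P. Colmez, Math. Ann. 292 (1992), §2.
* [Kato1993LNM1553] K. Kato, LNM 1553 (1993), Ch. II Ex. 1.3.5 ("`V_pA` is a de Rham representation").
-/

noncomputable section

namespace Literature.NumberTheory.PAdicHodge

open Literature Literature.NumberTheory.GaloisRepresentations Literature.NumberTheory.EllipticCurves WeierstrassCurve
open Literature.NumberTheory.GaloisRepresentations.IsNonarchimedeanLocalField Field ValuativeRel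

variable {F : Type} [Field F] [ValuativeRel F] [TopologicalSpace F] [IsNonarchimedeanLocalField F] [CharZero F]
  {p : ℕ} [Fact p.Prime] [Fact (¬ IsUnit (p : integerC F))] [IsAdicComplete (Ideal.span {(p : integerC F)}) (integerC F)]
  (hp : valuation F p < 1) [Algebra ℚ_[p] F]

/-- **Fontaine's theorem at good supersingular reduction (ℤ-models, `p ≥ 5`), unconditionally**: for `W/ℤ` with `p ∤ Δ_W` and
`A_p(W mod p) = 0`, `V_p(W ×_ℤ F)` is de Rham for every `p`-adic field `F`. [cite: Fontaine1982FormesDifferentielles, §5]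
[cite: Kato1993LNM1553, Ch. II Ex. 1.3.5] [cite: Colmez1992PeriodesAbeliennes, §2] -/
theorem isDeRham_rationalTateRep_curveF_of_goodSupersingular (W : WeierstrassCurve ℤ) [(AinfTop.curveF F W).IsElliptic]
    (hp5 : 5 ≤ p) (hΔ : ¬ (p : ℤ) ∣ W.Δ) (hA : (W.map (Int.castRingHom (ZMod p))).hasseCoeff p = 0) :
    GaloisRep.IsDeRham (bdRPeriodRingData (F := F) (p := p) hp) (rationalTateRep (AinfTop.curveF F W) p) :=
  isDeRham_rationalTateRep_curveF_of_supersingular hp W hp5 hΔ hA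
    (Literature.NumberTheory.EllipticCurves.prime_not_dvd_coeff_formalQuasiPeriodIntegrand_of_hasseCoeff_eq_zero (by omega) W hΔ hA)

/-- **The same in the currency of `isDeRham_restrictedRationalTateRep`**: every elliptic curve `W₀` over a subfield `K₀ ⊆ F` whose
base change to `F` is `W ×_ℤ F` for a `ℤ`-model `W` with good supersingular reduction at `p ≥ 5` has de Rham `V_p|_{Γ_F}`
(e.g. `K₀ = ℚ`, `W₀ = W ×_ℤ ℚ`). BSD is not proved by this. [cite: Fontaine1982FormesDifferentielles, §5] [cite: Kato1993LNM1553, Ch. II Ex. 1.3.5] -/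
theorem isDeRham_restrictedRationalTateRep_of_goodSupersingular {K₀ : Type} [Field K₀] [CharZero K₀] [Algebra K₀ F]
    (W₀ : WeierstrassCurve K₀) [W₀.IsElliptic] (W : WeierstrassCurve ℤ) (hW : W₀.baseChange F = AinfTop.curveF F W)
    (hp5 : 5 ≤ p) (hΔ : ¬ (p : ℤ) ∣ W.Δ) (hA : (W.map (Int.castRingHom (ZMod p))).hasseCoeff p = 0) :
    GaloisRep.IsDeRham (bdRPeriodRingData (F := F) (p := p) hp) (restrictedRationalTateRep W₀ F p) :=
  isDeRham_restrictedRationalTateRep_of_supersingular hp W₀ W hW hp5 hΔ hA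
    (Literature.NumberTheory.EllipticCurves.prime_not_dvd_coeff_formalQuasiPeriodIntegrand_of_hasseCoeff_eq_zero (by omega) W hΔ hA)

omit [ValuativeRel F] [TopologicalSpace F] [IsNonarchimedeanLocalField F] [CharZero F] in
/-- For `W/ℤ`, the base change to `F` of its generic fibre `W ×_ℤ ℚ` is `W ×_ℤ F` (`ℤ → ℚ → F = ℤ → F`).
[cite: SilvermanAEC2009, VII.1] -/
theorem baseChange_map_intCast_eq_curveF (W : WeierstrassCurve ℤ) [Algebra ℚ F] :
    (W.map (Int.castRingHom ℚ)).baseChange F = AinfTop.curveF F W := by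
  rw [WeierstrassCurve.baseChange, WeierstrassCurve.map_map]
  congr 1
  exact RingHom.ext_int _ _

/-- **hDR|ss for the generic fibre `W ×_ℤ ℚ` of a `ℤ`-model** (`K₀ = ℚ` instance of
`isDeRham_restrictedRationalTateRep_of_goodSupersingular`): for `W/ℤ`, a prime `p ≥ 5` with `p ∤ Δ_W` and `A_p(W mod p) = 0`, and any
`p`-adic field `F` (any `ℚ`- and `ℚ_p`-algebra structures), `V_p(W ×_ℤ ℚ)|_{Γ_F}` is de Rham — the form consumed for elliptic curves
over `ℚ` given by an integral equation with good supersingular reduction at `p` (other `ℚ`-models: `isDeRham_restrictedRationalTateRep_iff_of_isIsogenous`).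
[cite: Fontaine1982FormesDifferentielles, §5] [cite: Kato1993LNM1553, Ch. II Ex. 1.3.5] -/
theorem isDeRham_restrictedRationalTateRep_rat_of_goodSupersingular [Algebra ℚ F] (W : WeierstrassCurve ℤ)
    [(W.map (Int.castRingHom ℚ)).IsElliptic] (hp5 : 5 ≤ p) (hΔ : ¬ (p : ℤ) ∣ W.Δ)
    (hA : (W.map (Int.castRingHom (ZMod p))).hasseCoeff p = 0) :
    GaloisRep.IsDeRham (bdRPeriodRingData (F := F) (p := p) hp) (restrictedRationalTateRep (W.map (Int.castRingHom ℚ)) F p) :=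
  isDeRham_restrictedRationalTateRep_of_goodSupersingular hp (W.map (Int.castRingHom ℚ)) W
    (baseChange_map_intCast_eq_curveF W) hp5 hΔ hA

end Literature.NumberTheory.PAdicHodge

end
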